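import Summits.BirchSwinnertonDyer.BirchSwinnertonDyer.Theorems.UniversalToricDescentRationalSplitIMCInclusionAtThreeClosedModuloV87
import Summits.BirchSwinnertonDyer.BirchSwinnertonDyer.Theorems.UniversalToricDescentToricFrameExistsOfBDPDefs
import HarnessLib

/-!
# The rational wall `RationalSplitIMCInclusionAtThree` (stmt-BirchSwinnertonDyer-24207) CLOSED MODULO {(E|L) existence of a ♯♯-frame GIVEN a
# non-zero BDP frame, Jacquet's cone fact, Nekovář's fact, K2-rat} — stub 1 RESTRICTED TO THE CRUX'S OWN HYPOTHESIS
# (certificate `V89`, `--supports stmt-BirchSwinnertonDyer-24207`; cell `pub/bsd-wall`, LEAD `cruxlead-24207` g39)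

WHY THIS FILE. The crux is `∀ (data) (Ω_K Ω_p L), Ω_K ≠ 0 → Ω_p ≠ 0 → IsBDPLFunction ι′ 𝔭 κ γ f_E Ω_K Ω_p L → ∃ k, 3^k·L ∈ Ch_Λ(X_ac)·R₀⟦T⟧`:
a statement about a GIVEN integral one-variable frame `L`. Every certificate V3–V88 consumed the first stub of the line `ratwall_thin_comb`
(v11: (E) `ToricFrameExistsAtThree`, the BARE existence of a two-variable ♯♯-frame) UNCONDITIONALLY, although the composition applies it only at
crux data that come with `L`, and needs it only when `L ≠ 0` (for `L = 0` the conclusion holds with `k = 0`). This file re-runs the v7/v8.2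
composition with the first stub in the CONDITIONAL form (E|L) `…ToricFrameExistsOfBDPDefs.ToricFrameExistsOfBDPFrameAtThree` — «given
`Ω_K, Ω_p ≠ 0` and `L ≠ 0` with `IsBDPLFunction ι′ 𝔭 κ γ f_E Ω_K Ω_p L`, a ♯♯-frame exists in every `𝔭`-adapted pair» —, which (E) implies
trivially and which is vacuous exactly where the crux is:

* `RationalSplitIMCInclusionAtThree_of_existsOfBDP_of_jacquet_of_nekovar_of_ratCombDvd` : the crux BY NAME from (E|L) (as a text) + Jacquet's
  cone fact + Nekovář's fact + K2-rat (item 32493's text). PROOF = the v7 composition (`…ClosedModuloV7`) with three changes: the case `L = 0` is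
  settled first (`k = 0`); the frame is taken from (E|L) at the crux's `(Ω_K, Ω_p, L)`; its symmetry clause is the FRAME FUNCTIONAL EQUATION
  (`…ThinComb.FrameFunctionalEquation.associated_frameSubst`, every frame); K4 comes from Nekovář's fact through
  `charIdealInvSymmUpTo2_of_nekovar` and `charIdealSymm_of_charIdealInvSymm` (the `c`-transport is a tree theorem). The rest — frame, principal
  generator, ♯♯ cross-period rigidity, torsion dichotomy, line congruence, weak-reflection rigidity for `ρ := φ_{A_τ}`, no-pseudo-null, rational
  descent — is byte-identical with v7.
* `RationalSplitIMCInclusionAtThree_of_named` : the same with all four inputs BY NAME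
  (`ToricFrameExistsOfBDPFrameAtThree → jacquet1972_… → nekovar2006_… → RatThinCombDvdUpToTwoAtThree → RationalSplitIMCInclusionAtThree`).
(The v11 reading (E) + … ⟹ crux is `…ClosedModuloV88.RationalSplitIMCInclusionAtThree_of_named`; it also follows from the above through
(E) ⟹ (E|L), `…ToricFrameExistsOfBDPDefs.toricFrameExistsOfBDPFrame_of_toricFrameExists` — not restated here.)

READING (skeleton v12): 24207 = closed modulo FOUR NAMED statements {(E|L) `ToricFrameExistsOfBDPFrameAtThree` (adaptation: Hida 1988 Thm. 5.1b ⊗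
Castella–Wan 2.11/2.12 at the additive split 3, asked ONLY above a non-zero integral BDP frame) ⊕ item 32493 ⊕ Jacquet 1972 (typed) ⊕ Nekovář 2006
(typed)}. HONEST SCOPE: none of the four inputs is proved here; nothing here is evidence that an integral one- or two-variable frame exists at an
additive split `3` (in print the one-variable function exists as a DISTRIBUTION: Liu–Zhang–Zhang 2018); BSD is proved for no curve; 24207 / 20395 /
20186 / 32493 OPEN.

References: [cite: Jacquet1972, §19 Thm. 19.14, Cor. 19.15] [cite: Hida1988AIF, §5 Thm. 5.1b] [cite: CastellaWan2023, §2.4 Thm. 2.11, Cor. 2.12 (arXiv:1607.02019)]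
[cite: LiuZhangZhang2018, Thm. 1.8 (arXiv:1511.08172)] [cite: Nekovar2006, Thm. 8.9.9, Prop. 9.6.6 (ii)] [cite: Gu2025FiniteSlopeUniversalRS, Conj. 2.15 (arXiv:2512.01184)]
[cite: BuyukbodukLei2017, Def. 3.8 (arXiv:1707.00557)] [cite: MilneADT2006, I Thm. 4.10 (a) (p. 57)]
-/

set_option linter.dupNamespace false
set_option autoImplicit false

noncomputable section

open scoped Classical MatrixGroups

namespace Summit.BirchSwinnertonDyer.BirchSwinnertonDyer.Theorems.UniversalToricDescentRatwallThinCombLine.V89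

open NumberField IsDedekindDomain Field
open Literature.NumberTheory.EllipticCurves Literature.NumberTheory.GaloisRepresentations
open Literature.NumberTheory.EllipticCurves.ModularForms
open Summit.BirchSwinnertonDyer.BirchSwinnertonDyer.Theorems.UniversalToricDescentThinComb

/-- **THE CRUX BY NAME from (E|L), Jacquet's cone fact, Nekovář's fact and K2-rat.** `hE'` is the text of
`…ToricFrameExistsOfBDPDefs.ToricFrameExistsOfBDPFrameAtThree` (a ♯♯-frame exists GIVEN the crux's non-zero BDP frame `L`), `hK2` the text of item
stmt-BirchSwinnertonDyer-32493. The v7 composition, with the case `L = 0` settled by `k = 0`, the frame taken at the crux's `(Ω_K, Ω_p, L)`, its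
symmetry clause supplied by the frame functional equation, and K4 from Nekovář's fact. Conditional; closes nothing by itself.
[cite: Jacquet1972, §19 Thm. 19.14, Cor. 19.15] [cite: Nekovar2006, Thm. 8.9.9, Prop. 9.6.6 (ii)] [cite: Hida1988AIF, §5 Thm. 5.1b]
[cite: Gu2025FiniteSlopeUniversalRS, Conj. 2.15 (arXiv:2512.01184)] [cite: BuyukbodukLei2017, Def. 3.8 (arXiv:1707.00557)] [cite: MilneADT2006, I Thm. 4.10 (a) (p. 57)] -/
theorem RationalSplitIMCInclusionAtThree_of_existsOfBDP_of_jacquet_of_nekovar_of_ratCombDvd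
    (hE' :
        ∀ (W : WeierstrassCurve ℚ) [W.IsElliptic] [W.IsGloballyMinimal] (N : ℕ) [NeZero N] (K : Type) [Field K]
          [NumberField K] (Dt : Literature.NumberTheory.EllipticCurves.ModularForms.ModularParametrizationData W N),
        Summit.BirchSwinnertonDyer.Rank1Residual.Additive.ClassO6 W 3 → W.HasSurjectiveModNGaloisRep 3 →
        W.analyticRank = 1 → W.conductorNorm ℤ = N → IsImaginaryQuadratic K → SatisfiesHeegnerHypothesis N K →
        ∀ (κ' : ZpExtension K 3), κ'.IsAnticyclotomic → ∀ (γ : Field.absoluteGaloisGroup K) [Fact (κ'.IsTopGenerator γ)]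
          (𝔭 : HeightOneSpectrum (𝓞 K)), ((3 : ℕ) : 𝓞 K) ∈ 𝔭.asIdeal →
          𝔭.asIdeal.ramificationIdx (𝓞 ℚ) = 1 → 𝔭.asIdeal.inertiaDeg (𝓞 ℚ) = 1 →
        ∀ (𝔭' : HeightOneSpectrum (𝓞 K)), ((3 : ℕ) : 𝓞 K) ∈ 𝔭'.asIdeal → 𝔭' ≠ 𝔭 →
        ∀ (ι' : PadicAlgCl 3 ≃+* ℂ), Summit.BirchSwinnertonDyer.BirchSwinnertonDyer.Theorems.SchneiderFree.BranchInducesPrime 3 ι' 𝔭 →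
        ∀ (ΩK : ℂ) (Ωp : ℂ_[3]) (L : UnrSeries 3), ΩK ≠ 0 → Ωp ≠ 0 → IsBDPLFunction ι' 𝔭 κ' γ Dt.f ΩK Ωp L → L ≠ 0 →
        ∀ (κ₁ κ₂ : ZpExtension K 3) (γ₁ γ₂ : Field.absoluteGaloisGroup K) (k : ℕ)
          [Fact (ZpExtension.IsTopGeneratorPair κ₁ κ₂ γ₁ γ₂)],
        (∀ v : HeightOneSpectrum (𝓞 K), v ≠ 𝔭 → ∀ 𝔓 ∈ v.primesAbove,
            𝔓.inertia (Field.absoluteGaloisGroup K) ≤ κ₁.kerSubgroup) →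
        ZpExtension.pairKer κ₁ κ₂ ≤ κ'.kerSubgroup → γ₁ * γ⁻¹ ∈ κ'.kerSubgroup → γ₂ * (γ ^ (3 ^ k))⁻¹ ∈ κ'.kerSubgroup →
        ∃ (ΩK' : ℂ) (C X Y : ℂ_[3]) (L₂ : PowerSeries (PowerSeries (unrIntegers 3))),
          ΩK' ≠ 0 ∧ C ≠ 0 ∧ X ≠ 0 ∧ Y ≠ 0 ∧
          IsToricTwoVarLFunctionUpTo₂ C X Y ι' 𝔭 𝔭' κ₁ κ₂ γ₁ γ₂ Dt.f ΩK' L₂)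
    (hJ : Literature.NumberTheory.EllipticCurves.jacquet1972_functionalEquation_rankinSelbergHecke_cone)
    (hNek : Literature.NumberTheory.EllipticCurves.nekovar2006_xGr₂_isTorsion_iff_and_charIdeal_eq_map_inv)
    (hK2 :
        ∀ (W : WeierstrassCurve ℚ) [W.IsElliptic] [W.IsGloballyMinimal] (N : ℕ) [NeZero N] (K : Type) [Field K]
          [NumberField K] (Dt : Literature.NumberTheory.EllipticCurves.ModularForms.ModularParametrizationData W N),
        Summit.BirchSwinnertonDyer.Rank1Residual.Additive.ClassO6 W 3 → W.HasSurjectiveModNGaloisRep 3 →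
        W.analyticRank = 1 → W.conductorNorm ℤ = N → IsImaginaryQuadratic K → SatisfiesHeegnerHypothesis N K →
        ∀ (𝔭 : HeightOneSpectrum (𝓞 K)), ((3 : ℕ) : 𝓞 K) ∈ 𝔭.asIdeal →
          𝔭.asIdeal.ramificationIdx (𝓞 ℚ) = 1 → 𝔭.asIdeal.inertiaDeg (𝓞 ℚ) = 1 →
        ∀ (𝔭' : HeightOneSpectrum (𝓞 K)), ((3 : ℕ) : 𝓞 K) ∈ 𝔭'.asIdeal → 𝔭' ≠ 𝔭 →
        ∀ (ι' : PadicAlgCl 3 ≃+* ℂ), Summit.BirchSwinnertonDyer.BirchSwinnertonDyer.Theorems.SchneiderFree.BranchInducesPrime 3 ι' 𝔭 →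
        ∀ (κ₁ κ₂ : ZpExtension K 3) (γ₁ γ₂ : Field.absoluteGaloisGroup K)
          [Fact (ZpExtension.IsTopGeneratorPair κ₁ κ₂ γ₁ γ₂)],
        (∀ v : HeightOneSpectrum (𝓞 K), v ≠ 𝔭 → ∀ 𝔓 ∈ v.primesAbove,
            𝔓.inertia (Field.absoluteGaloisGroup K) ≤ κ₁.kerSubgroup) →
        Module.Finite (IwasawaAlgebra₂ 3) ((W.baseChange K).XGr₂ 3 κ₁ κ₂ 𝔭' γ₁ γ₂) →
        Module.IsTorsion (IwasawaAlgebra₂ 3) ((W.baseChange K).XGr₂ 3 κ₁ κ₂ 𝔭' γ₁ γ₂) →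
        ∀ (g : IwasawaAlgebra₂ 3),
          Literature.NumberTheory.EllipticCurves.Module.charIdeal (IwasawaAlgebra₂ 3)
            ((W.baseChange K).XGr₂ 3 κ₁ κ₂ 𝔭' γ₁ γ₂) = Ideal.span {g} →
        ∀ (ΩK' : ℂ) (C X Y : ℂ_[3]) (L₂ : PowerSeries (PowerSeries (unrIntegers 3))), ΩK' ≠ 0 → C ≠ 0 → X ≠ 0 → Y ≠ 0 →
          IsToricTwoVarLFunctionUpTo₂ C X Y ι' 𝔭 𝔭' κ₁ κ₂ γ₁ γ₂ Dt.f ΩK' L₂ →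
        ThinCombDvdRat (unrIntegers 3) 3
          (PowerSeries.map (PowerSeries.map (Summit.BirchSwinnertonDyer.Rank1Residual.X11b.Halves.toUnr 3)) g) L₂) :
    Summit.BirchSwinnertonDyer.BirchSwinnertonDyer.Theses.UniversalToricDescent.RationalSplitIMCInclusionAtThree := by
  -- K4 in the v7 shape `φ_{A_τ} G ∼ G`, from Nekovář's fact (`…ClosedModuloPrint`) and the `c`-transport (`…ClosedModuloV8`)
  have hK4 := charIdealSymm_of_charIdealInvSymm (charIdealInvSymmUpTo2_of_nekovar hNek)
  intro W _ _ N _ K _ _ Dt hO6 hsurj hrk hN hK hH κ hκ γ hγ 𝔭 h3 hram hdeg 𝔭' h3' hne ι' hι ΩK Ωp L hΩK hΩp hL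
  -- the zero frame: `k = 0`
  by_cases hL0 : L = 0
  · exact ⟨0, by rw [hL0, mul_zero]; exact Ideal.zero_mem _⟩
  obtain ⟨κ₁, κ₂, γ₁, γ₂, k, hpair, hur₁, hker, hγ₁, hγ₂⟩ :=
    Summit.BirchSwinnertonDyer.BirchSwinnertonDyer.Theorems.UniversalToricDescentThinCombLine.stub_frame
      K hK κ hκ γ hγ.out 𝔭 h3 𝔭' h3' hne
  haveI : Fact (ZpExtension.IsTopGeneratorPair κ₁ κ₂ γ₁ γ₂) := ⟨hpair⟩
  obtain ⟨g₂, hg₂⟩ :=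
    Summit.BirchSwinnertonDyer.BirchSwinnertonDyer.Theorems.UniversalToricDescentThinCombLine.stub_charIdealPrincipal
      ((W.baseChange K).XGr₂ 3 κ₁ κ₂ 𝔭' γ₁ γ₂)
  have hg₂' : Literature.NumberTheory.EllipticCurves.Module.charIdeal (IwasawaAlgebra₂ 3)
      ((W.baseChange K).XGr₂ 3 κ₁ κ₂ 𝔭' γ₁ γ₂) = Ideal.span {g₂} := by
    simpa [Ideal.submodule_span_eq] using hg₂
  have hfin : Module.Finite (IwasawaAlgebra₂ 3) ((W.baseChange K).XGr₂ 3 κ₁ κ₂ 𝔭' γ₁ γ₂) :=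
    Summit.BirchSwinnertonDyer.BirchSwinnertonDyer.Theorems.SignedBaseChangeAcDivFinitePiece.xGr₂_module_finite
      (W.baseChange K) 3 κ₁ κ₂ 𝔭'
  -- the FRAME INVOLUTION `A = A_τ` (tree): `c ∈ Γ_ℚ ∖ res(Γ_K)`, a lift `τ` of `σ ↦ c σ⁻¹ c⁻¹`, its matrix in the pair
  obtain ⟨c, hc⟩ := FrameInvolution.exists_not_mem_range_absGaloisRestrict_rat hK
  obtain ⟨τ, hτ⟩ := FrameInvolution.exists_conjInv hK.1 c
  obtain ⟨A, hA, -⟩ := FrameInvolution.exists_GL_eq_frameMatrixOf_of_conjInv (p := 3) hK hpair hτ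
  -- (E|L): a ♯♯-frame `L₂`, GIVEN the crux's non-zero BDP frame `L`
  obtain ⟨ΩK', C, X, Y, L₂, hΩK', hC, hX, hY, hL₂⟩ :=
    hE' W N K Dt hO6 hsurj hrk hN hK hH κ hκ γ 𝔭 h3 hram hdeg 𝔭' h3' hne ι' hι ΩK Ωp L hΩK hΩp hL hL0 κ₁ κ₂ γ₁ γ₂ k
      hur₁ hker hγ₁ hγ₂
  -- K3(iii) for THIS frame: the frame functional equation `φ_{A_τ} L₂ ∼ L₂` (every ♯♯-frame; Jacquet's cone fact BY NAME)
  have hLsym := FrameFunctionalEquation.associated_frameSubst hJ hK W Dt hH h3 h3' hne ι' hι hpair hur₁ hc hτ A hA hX hY hL₂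
  -- ♯♯ cross-period rigidity WITHOUT the Rankin–Selberg continuation: `L = 0` or `3^a·spec (3^k) L₂ = 3^b·(w·L)`
  rcases Summit.BirchSwinnertonDyer.BirchSwinnertonDyer.Theorems.UniversalToricDescentRatwallThinComb.ContRigidityUpTo.eq_zero_or_rel_spec_of_toricUpTo₂_values
      K N Dt.f hK κ hκ γ hγ.out 𝔭 h3 𝔭' h3' hne ι' κ₁ κ₂ γ₁ γ₂ k hpair hγ₁ hγ₂ hΩK hΩp hL hΩK' hC hX hY
      (fun ψ a b ha hb hinf hunr r hr hκr Lc hLd hLe ↦ hL₂.hasValueAt₂ ha hb hinf hunr hr hκr hLd hLe) with h0 | ⟨a₀, b₀, w, hw, hrel⟩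
  · exact ⟨0, by rw [h0, mul_zero]; exact Ideal.zero_mem _⟩
  -- TORSION DICHOTOMY: off the torsion locus of `X₂` the rational inclusion is trivial (`Ch_Λ(X_ac) = ⊤`)
  by_cases htors : Module.IsTorsion (IwasawaAlgebra₂ 3) ((W.baseChange K).XGr₂ 3 κ₁ κ₂ 𝔭' γ₁ γ₂)
  swap
  · have hnt := Summit.BirchSwinnertonDyer.BirchSwinnertonDyer.Theorems.UniversalToricDescentThinCombLine.stub_torsionTransfer
      W K hO6 hsurj hK κ hκ γ 𝔭 h3 𝔭' h3' hne κ₁ κ₂ γ₁ γ₂ k hur₁ hker hγ₁ hγ₂ htors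
    refine ⟨0, ?_⟩
    rw [pow_zero, one_mul]
    exact (Ideal.span_singleton_le_iff_mem _).mp
      (Summit.BirchSwinnertonDyer.BirchSwinnertonDyer.Theorems.UniversalToricDescentCharIdealVacuity.span_le_map_charIdeal_of_not_isTorsion
        hnt _ L)
  -- the comparison clause of v1 HOLDS for `L♮ := spec (3^k) L₂` with `u = 1`, `t = s = 0`
  have hcmp : ∃ (u : (PowerSeries (PowerSeries (unrIntegers 3)))ˣ) (t s : ℕ),
      const (unrIntegers 3) (((3 : ℕ) : unrIntegers 3) ^ t) * L₂ -
        u * const (unrIntegers 3) (((3 : ℕ) : unrIntegers 3) ^ s) *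
          PowerSeries.map (PowerSeries.C (R := unrIntegers 3)) (TwoVarSubst.spec (3 ^ k) L₂) ∈
        Ideal.span {T₂ (unrIntegers 3) - ((1 + T₁ (unrIntegers 3)) ^ (3 ^ k) - 1)} := by
    refine ⟨1, 0, 0, ?_⟩
    rw [pow_zero, map_one, one_mul, mul_one]
    exact LineValue.sub_one_mul_map_spec_mem_lineIdeal (3 ^ k) L₂
  -- K4: the algebraic functional equation `φ_A G ∼ G` (Nekovář's fact + `c`-transport)
  have hGsym :=
    hK4 W N K Dt hO6 hsurj hrk hN hK hH 𝔭 h3 hram hdeg 𝔭' h3' hne κ₁ κ₂ γ₁ γ₂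
      hur₁ hfin htors g₂ hg₂' c hc τ hτ A hA
  -- the frame geometry `A 0 1 ≠ 0` (tree: `κ₁ ∘ θ_c` is unramified outside `𝔭′`, so it cannot vanish on `γ₂`)
  have hb : (A : Matrix (Fin 2) (Fin 2) ℤ_[3]) 0 1 ≠ 0 :=
    FrameInvolution.frameMatrixOf_zero_one_ne_zero_of_natCast_mem hK hpair h3 h3' hne hur₁ hc hτ hA
  -- K2-rat: rational thin-comb divisibility for the frame `L₂`
  have hcomb :=
    hK2 W N K Dt hO6 hsurj hrk hN hK hH 𝔭 h3 hram hdeg 𝔭' h3' hne ι' hι κ₁ κ₂ γ₁ γ₂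
      hur₁ hfin htors g₂ hg₂' ΩK' C X Y L₂ hΩK' hC hX hY hL₂
  -- rigidity (Part VII) for the weak reflection `ρ := φ_A`: it fixes constants and `φ_A T₂ ∉ (3, T₂)` because `A 0 1 ≠ 0`
  letI : Algebra ℤ_[3] (unrIntegers 3) := (Summit.BirchSwinnertonDyer.Rank1Residual.X11b.Halves.toUnr 3).toAlgebra
  haveI := Summit.BirchSwinnertonDyer.Rank1Residual.X2.HidaLimitAlgebra.isDiscreteValuationRing_unrIntegers (p := 3)
  have hmax : IsLocalRing.maximalIdeal (unrIntegers 3) = Ideal.span {((3 : ℕ) : unrIntegers 3)} :=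
    (IsDiscreteValuationRing.irreducible_iff_uniformizer _).mp
      Summit.BirchSwinnertonDyer.Rank1Residual.X2.HidaLimitAlgebra.irreducible_natCast_p
  obtain ⟨a, hdvd⟩ := dvd_pow_mul_of_weakReflection (unrIntegers 3) 3 hmax (IwasawaAlgebra₂.frameSubst (unrIntegers 3) A)
    (GroupLikeReflection.frameSubst_const (unrIntegers 3) A)
    (GroupLikeReflection.frameSubst_T₂_not_mem (unrIntegers 3) A
      Summit.BirchSwinnertonDyer.Rank1Residual.X2.HidaLimitAlgebra.irreducible_natCast_p.not_isUnit hb)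
    _ L₂ hGsym hLsym hcomb
  have hPN :=
    Summit.BirchSwinnertonDyer.BirchSwinnertonDyer.Theorems.UniversalToricDescentThinComb.NoPseudoNullOfPoitouTate.stub_noPseudoNull_of_poitouTateAt
      Summit.BirchSwinnertonDyer.BirchSwinnertonDyer.Theorems.PoitouTateShaNaturalAtTC.forall_poitouTate_shaRestricted_tateDual_natural_at_of_isTotallyComplex
      W K hO6 hsurj hK κ hκ γ 𝔭 h3 𝔭' h3' hne κ₁ κ₂ γ₁ γ₂ k hur₁ hker hγ₁ hγ₂ hfin htors
  obtain ⟨k', hk'⟩ :=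
    Summit.BirchSwinnertonDyer.BirchSwinnertonDyer.Cruxes.ToricTransportModThree.RatwallThinComb.stub_ratDescent
      W K hO6 hsurj hK κ hκ γ 𝔭 h3 𝔭' h3' hne κ₁ κ₂ γ₁ γ₂ k hur₁ hker hγ₁ hγ₂ hfin htors hPN g₂ hg₂' L₂
      (TwoVarSubst.spec (3 ^ k) L₂) a hdvd hcmp
  -- transport from `L♮ = spec (3^k) L₂` to the handed frame along `3^a·L♮ = 3^b·(w·L)`: slack `k' + b`
  exact ⟨k' + b₀,
    Summit.BirchSwinnertonDyer.BirchSwinnertonDyer.Theorems.UniversalToricDescentRatwallThinComb.ContRigidityUpTo.pow_mul_mem_of_rel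
      hw hrel hk'⟩

/-- **THE RATIONAL WALL FROM FOUR NAMED STATEMENTS (v12)**: the conditional toric existence (E|L) (`@[conjecture]` constant
`…ToricFrameExistsOfBDPDefs.ToricFrameExistsOfBDPFrameAtThree`), Jacquet's cone functional equation (print), Nekovář's two-variable algebraic
functional equation (print) and the rational thin-comb divisibility K2-rat (route item stmt-BirchSwinnertonDyer-32493, research) imply
`RationalSplitIMCInclusionAtThree` — the constants unfolding definitionally. [cite: Hida1988AIF, §5 Thm. 5.1b] [cite: Jacquet1972, §19 Thm. 19.14, Cor. 19.15]
[cite: Nekovar2006, Thm. 8.9.9, Prop. 9.6.6 (ii)] [cite: Gu2025FiniteSlopeUniversalRS, Conj. 2.15 (arXiv:2512.01184)] -/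
theorem RationalSplitIMCInclusionAtThree_of_named
    (hE' : Summit.BirchSwinnertonDyer.BirchSwinnertonDyer.Theorems.UniversalToricDescentToricFrameExistsOfBDPDefs.ToricFrameExistsOfBDPFrameAtThree)
    (hJ : Literature.NumberTheory.EllipticCurves.jacquet1972_functionalEquation_rankinSelbergHecke_cone)
    (hNek : Literature.NumberTheory.EllipticCurves.nekovar2006_xGr₂_isTorsion_iff_and_charIdeal_eq_map_inv)
    (hK2 : Summit.BirchSwinnertonDyer.BirchSwinnertonDyer.Theses.UniversalToricDescent.RatThinCombDvdUpToTwoAtThree) :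
    Summit.BirchSwinnertonDyer.BirchSwinnertonDyer.Theses.UniversalToricDescent.RationalSplitIMCInclusionAtThree :=
  RationalSplitIMCInclusionAtThree_of_existsOfBDP_of_jacquet_of_nekovar_of_ratCombDvd hE' hJ hNek hK2

end Summit.BirchSwinnertonDyer.BirchSwinnertonDyer.Theorems.UniversalToricDescentRatwallThinCombLine.V89

end
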